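import Summits.QuantumFields.YangMills.Theorems.FluctuationComparisonRegPrIntLS2BetaJunctionEnergy
import HarnessLib

/-!
# S2β · (JNC-E)′ «E_J IS A K-UNIFORM PURSE-SHARE AT A DECAYING REPRESENTATIVE» — ✓p839973 `junctionEnergy_le_purse` read at the sup-decay letter
# `‖ζ ℓ‖ ≤ c·(L⁻¹)^{K−J}` (`4c ≤ 1`): `E_J ≤ (2304·w(1)·c²·L)·purse` for every `J ≤ K`, and `E_J ≤ (2304·w(1)·c²·L⁻¹)·purse` once `2 ≤ K − J`;
# and the same for the junction ROW `L^{K−J−2}·Σ junction₀(X)²` of w4 g29's discharged c₁ letter (d) (text VERBATIM): `≤ (768·c²·L)·purse`, resp. `(768·c²·L⁻¹)·purse`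

Cell `ym3-torus` (YM ladder rung R3 = continuum `SU(2)` Yang–Mills on the three-torus at fixed lattice data — a RUNG: NOT d = 4, NOT infinite volume,
NOT a mass gap, NOT Clay).  Width seat «width 21» `ym3-torus-px21` (gen 26), FREE px helper on crux `stmt-QuantumFields-20520`
(`…Theses.UnitScaleTilt.FluctuationComparisonRegPrIntL`), LINE g18-1 S2β; my (JNC-E) lineage (✓p839973) and my COUNT «E_J-FACE» (bus 2026-09-01T01:58Z): the
junction energy is a purse-share with a K-UNIFORM constant exactly when the finest chart sizes decay like `(L⁻¹)^{K−J}` — the (SUP-DECAY)₀ letter, which the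
Lipschitz lift ✓p840262 `exists_lipschitzLift` makes AVAILABLE on the lift side (`2π·τ′·(L⁻¹)^{K−J}` per fine bond) and whose representative side is the lane's
(REG)∕(RES-u.6)∕(RES-u.7σ)∕(C-σ) rows (others'; DISPLAYED here as the hypothesis `hζc`, not inhabited).  Consumers: w4 g29 (b′) `c1Budget_of_bkg_letters_volR`'s
bracket `… + 3·E_J(w,X)` (the E_J summand becomes `≤ const·purse` BY NAME under `hζc`), architect px17 g23 RULING «THE WEIGHT LINE» v2 (`w 1 := 1`).
`--kind proof --supports stmt-QuantumFields-20520 --as helper`, count-neutral, DEFINITION-FREE (0 `def`, 0 `instance`, 0 `notation`, 0 `sorry`, default heartbeats).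

WHAT IS PROVED (sorry-free; `E_J` = ✓p839415 `Bsrc_split_le`'s third summand, text VERBATIM; `purse := (L⁻¹)^{K−J}·Σ_ℓ‖ζ ℓ‖² + L^{K−J}·Σ_p(1 − reTr((P_{U₀}p)⁻¹·P_{e^ζU₀}p))`,
✓p838848's text; `X` = ✓`linBudget_of_chartTower`'s naked tower at `hXdef`).  ★`purse_nonneg`; ★★**`junctionEnergy_le_purse_of_supDecay (hw : 0 ≤ w 1) (c) (hc0 : 0 ≤ c)
(hc4 : 4c ≤ 1) (hζc : ∀ ℓ, ‖ζ ℓ‖ ≤ c·((F.L:ℝ)⁻¹)^(K−J)) : E_J ≤ (2304·w 1·c²·L)·purse`** (all `J ≤ K`; `M₀ := c·(L⁻¹)^{K−J}` in ✓`junctionEnergy_le_purse`, then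
`M₀²·L^{K−J−1−1}·L·L^{K−J} ≤ c²·L` because truncated `K−J−1−1 ≤ K−J` and `(L⁻¹)^{K−J}·L^{K−J} = 1`); ★★**`junctionEnergy_le_purse_of_supDecay_sharp (h2 : 2 ≤ K − J) … :
E_J ≤ (2304·w 1·c²·L⁻¹)·purse`** (exact exponent count `M₀²·L^{K−J−2}·L·L^{K−J} = c²·L⁻¹`).  With «WEIGHT LINE» v2 (`w 1 = 1`) and `c ≤ 1∕4`: `E_J ≤ 144·L·purse`, resp.
`≤ 144·L⁻¹·purse` — K-UNIFORM, as plan (3) wants for an S′∕purse share.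
§2 THE JUNCTION ROW in the currency of w4 g29's (d) `c1Budget_discharged` (its bracket term `3·(L^{K−J−2}·Σ_μΣ_νΣ_{y′ : Site (F.P K) (0+1)} junction₀(X)²)`, the row
text VERBATIM from w4's file 983f53ec `junctionRow_le_of_weightOne`'s right-hand side): ★`junctionRow_le (X) (M₀) (hM0 : ∀ b, ‖X 0 b‖ ≤ M₀) (hM4)` : `Σ junction₀(X)² ≤
L⁴·(L³)⁻¹·(256·3·M₀²·Σ_b‖X 0 b‖²)` (the `i = 0` instance of ✓`junctionEnergy_le`'s two counts ✓`sum_sq_idxAvg_le` ∘ ✓`sum_sq_rem_le`, now stated on its own);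
★★**`junctionRow_le_purse_of_supDecay (U₀ ζ X hXdef) (c) (hc0) (hc4) (hζc) : L^{K−J−2}·Σ junction₀(X)² ≤ (768·c²·L)·purse`** (every `J ≤ K`);
★★**`junctionRow_le_purse_of_supDecay_sharp … (h2 : 2 ≤ K − J) : … ≤ (768·c²·L⁻¹)·purse`**.  (`c ≤ 1∕4`: `48·L`, resp. `48·L⁻¹`.)

HONEST SCOPE.  One real inequality over ✓p839973's displayed texts; `ζ`, `w`, `c` FREE; `hζc` ((SUP-DECAY)₀ at the representative) is a HYPOTHESIS whose inhabitant is
the lane's (REG)@representative work (rows (RES-u.6)∕(7σ)∕(C-σ), ✓p840262 for the lift part) — NOT proved here; nothing of Bałaban's renormalisation-group analysis is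
asserted or proved ([Balaban1985Averaging, Prop. 4 (128)–(135) pp.37–38; Balaban1987RG1, (0.4), (0.11) p.253] are the printed rows these letters transcribe);
GAP♯∘ (`stub_uniformFibreGapOrbit`, registry `Lines/semiclassical_s2beta.lean` 3732b7df UNTOUCHED, 0∕5), S2β, the five registered stubs, crux 20520, 19936, 19200
and `YM3TorusSU2` are NOT proved; no registered stub is closed; rung R3 = SU(2) YM₃ on T³ at fixed lattice data — NOT d = 4, NOT infinite volume, NOT a mass
gap, NOT Clay; the Yang–Mills mass gap is NOT proved.
-/

set_option autoImplicit false

noncomputable section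

open scoped Matrix.Norms.L2Operator
open Finset

namespace Summit.QuantumFields.YangMills.Theorems.FluctuationComparisonRegPrIntLS2BetaJunctionEnergyShare

open Literature.MathematicalPhysics.QuantumFieldTheory.Balaban1983to89
open Literature.MathematicalPhysics.QuantumFieldTheory.Balaban1983to89.T4Continuum
open Literature.MathematicalPhysics.QuantumFieldTheory.Balaban1983to89.T3ContinuumYM3Torus
open Literature.MathematicalPhysics.QuantumFieldTheory.Balaban1983to89.HaarExponentialChart
open Literature.MathematicalPhysics.QuantumFieldTheory.Balaban1983to89.BlockAveraging (Idx)
open Literature.MathematicalPhysics.QuantumFieldTheory.Balaban1983to89.B10Eq47AxialChi (shiftN)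
open Literature.MathematicalPhysics.QuantumFieldTheory.Balaban1983to89.T4HaarSU2ExpChart (expPoint)
open Literature.MathematicalPhysics.QuantumFieldTheory.Balaban1983to89.T4ExpWindowSmallField (logVec)
open Literature.MathematicalPhysics.QuantumFieldTheory.Balaban1983to89.T3UnitLawDensityEML (ℰp)
open Literature.MathematicalPhysics.QuantumFieldTheory.Balaban1983to89.B10Eq18SigmaSU2 (su2Coord)
open Literature.MathematicalPhysics.QuantumFieldTheory.Balaban1983to89.B10Eq18SigmaSU2Haar (rev)
open Literature.MathematicalPhysics.QuantumLattice (su2Quat)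
open Summit.QuantumFields.YangMills.Theorems.FluctuationComparisonRegPrIntLS2BetaChartReadDescentOntoExpPoint (su2Coord_rev_mem_lie)
open Summit.QuantumFields.YangMills.Theorems.FluctuationComparisonRegPrIntLS2BetaJunctionEnergy
  (junctionEnergy_le_purse sum_sq_idxAvg_le sum_sq_rem_le norm_chartTower_zero_le)

variable (F : T3Family)

/-- ★ The purse is non-negative (squares, and `reTr ≤ 1` on `SU(2)`). [cite: Balaban1985Averaging, (2)-(3) p.17] -/
theorem purse_nonneg {J K : ℕ} (U₀ : GaugeField (F.P K) 0 (Matrix.specialUnitaryGroup (Fin 2) ℂ))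
    (ζ : PBond (F.P K) 0 → EuclideanSpace ℝ (Fin 3)) :
    0 ≤
        (((F.L : ℝ)⁻¹) ^ (K - J) * ∑ ℓ : PBond (F.P K) 0, ‖ζ ℓ‖ ^ 2 +
          (F.L : ℝ) ^ (K - J) * ∑ p : Plaq (F.P K) 0,
            (1 - reTr ((GaugeField.plaqHol U₀ p)⁻¹ * GaugeField.plaqHol (fun ℓ => expPoint (ζ ℓ) * U₀ ℓ : GaugeField (F.P K) 0 (Matrix.specialUnitaryGroup (Fin 2) ℂ)) p))) := by
  have hL0 : (0 : ℝ) < (F.L : ℝ) := by exact_mod_cast (lt_trans zero_lt_one F.hL.2)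
  have hREL : 0 ≤ ∑ p : Plaq (F.P K) 0,
      (1 - reTr ((GaugeField.plaqHol U₀ p)⁻¹ * GaugeField.plaqHol (fun ℓ => expPoint (ζ ℓ) * U₀ ℓ : GaugeField (F.P K) 0 (Matrix.specialUnitaryGroup (Fin 2) ℂ)) p)) :=
    Finset.sum_nonneg fun p _ => sub_nonneg.2 (GaugeGroup.reTr_le_one _)
  have hsq : 0 ≤ ∑ ℓ : PBond (F.P K) 0, ‖ζ ℓ‖ ^ 2 := Finset.sum_nonneg fun ℓ _ => by positivity
  positivity

/-- ★★ **`E_J` IS A `K`-UNIFORM PURSE-SHARE AT A DECAYING REPRESENTATIVE.**  If the finest fluctuation sizes obey the sup-decay letter `‖ζ ℓ‖ ≤ c·(L⁻¹)^{K−J}` with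
`4c ≤ 1`, then for every `J ≤ K` and every weight with `0 ≤ w 1`: `E_J ≤ (2304·w(1)·c²·L)·purse` (✓`junctionEnergy_le_purse` at `M₀ := c·(L⁻¹)^{K−J}`; the exponent
count `M₀²·L^{K−J−1−1}·L·L^{K−J} ≤ c²·L` uses truncated subtraction `K−J−1−1 ≤ K−J`).  With `w 1 = 1`, `c ≤ 1∕4`: `E_J ≤ 144·L·purse`.
[cite: Balaban1985Averaging, Prop. 4 (128)-(135) pp.37-38; Balaban1987RG1, (0.4), (0.11) p.253] -/
theorem junctionEnergy_le_purse_of_supDecay {J K : ℕ} (U₀ : GaugeField (F.P K) 0 (Matrix.specialUnitaryGroup (Fin 2) ℂ))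
    (ζ : PBond (F.P K) 0 → EuclideanSpace ℝ (Fin 3))
    (X : (i : ℕ) → PBond (F.P K) i → (specialUnitaryLogChart (Fin 2)).lie)
    (hXdef : X = fun (i : ℕ) (b : PBond (F.P K) i) =>
      (⟨su2Coord (rev (logVec (su2Quat (Averaging.iter (fun k => BlockAveraging.blockAvg (P := F.P K) (j := k) ℰp) i (fun ℓ => expPoint (ζ ℓ) * U₀ ℓ : GaugeField (F.P K) 0 (Matrix.specialUnitaryGroup (Fin 2) ℂ)) b * (Averaging.iter (fun k => BlockAveraging.blockAvg (P := F.P K) (j := k) ℰp) i U₀ b)⁻¹)))), su2Coord_rev_mem_lie _⟩ : (specialUnitaryLogChart (Fin 2)).lie))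
    (w : ℕ → ℝ) (hw : 0 ≤ w 1) (c : ℝ) (hc0 : 0 ≤ c) (hc4 : 4 * c ≤ 1)
    (hζc : ∀ ℓ : PBond (F.P K) 0, ‖ζ ℓ‖ ≤ c * ((F.L : ℝ)⁻¹) ^ (K - J)) :
      3 * ∑ i ∈ Finset.range (K - J), w (i + 1) * (F.L : ℝ) ^ (K - J - 1 - (i + 1)) *
          ∑ μ : Fin (F.P K).d, ∑ ν : Fin (F.P K).d, ∑ y' : Site (F.P K) (i + 1),
            (if i = 0 then ((Fintype.card (Idx (F.P K)) : ℝ)⁻¹ *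
            ∑ a ∈ (Finset.univ : Finset (Idx (F.P K))) ×ˢ (Finset.range (F.P K).L ×ˢ Finset.range (F.P K).L),
              (Real.exp (‖X i ⟨(shiftN (shiftN (Site.blockSite y' a.1.1) μ a.2.1) ν a.2.2), μ⟩‖ + ‖X i ⟨((shiftN (shiftN (Site.blockSite y' a.1.1) μ a.2.1) ν a.2.2)).shift μ, ν⟩‖ + ‖X i ⟨((shiftN (shiftN (Site.blockSite y' a.1.1) μ a.2.1) ν a.2.2)).shift ν, μ⟩‖ + ‖X i ⟨(shiftN (shiftN (Site.blockSite y' a.1.1) μ a.2.1) ν a.2.2), ν⟩‖) - 1 - (‖X i ⟨(shiftN (shiftN (Site.blockSite y' a.1.1) μ a.2.1) ν a.2.2), μ⟩‖ + ‖X i ⟨((shiftN (shiftN (Site.blockSite y' a.1.1) μ a.2.1) ν a.2.2)).shift μ, ν⟩‖ + ‖X i ⟨((shiftN (shiftN (Site.blockSite y' a.1.1) μ a.2.1) ν a.2.2)).shift ν, μ⟩‖ + ‖X i ⟨(shiftN (shiftN (Site.blockSite y' a.1.1) μ a.2.1) ν a.2.2), ν⟩‖))) else 0) ^ 2 ≤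
      (2304 * w 1 * c ^ 2 * (F.L : ℝ)) *
        (((F.L : ℝ)⁻¹) ^ (K - J) * ∑ ℓ : PBond (F.P K) 0, ‖ζ ℓ‖ ^ 2 +
          (F.L : ℝ) ^ (K - J) * ∑ p : Plaq (F.P K) 0,
            (1 - reTr ((GaugeField.plaqHol U₀ p)⁻¹ * GaugeField.plaqHol (fun ℓ => expPoint (ζ ℓ) * U₀ ℓ : GaugeField (F.P K) 0 (Matrix.specialUnitaryGroup (Fin 2) ℂ)) p))) := by
  have hL1 : (1 : ℝ) < (F.L : ℝ) := by exact_mod_cast F.hL.2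
  have hL0 : (0 : ℝ) < (F.L : ℝ) := by linarith
  have hq0 : 0 ≤ ((F.L : ℝ)⁻¹) ^ (K - J) := pow_nonneg (inv_nonneg.2 hL0.le) _
  have hq1 : ((F.L : ℝ)⁻¹) ^ (K - J) ≤ 1 := pow_le_one₀ (inv_nonneg.2 hL0.le) (inv_le_one_of_one_le₀ hL1.le)
  have hM4 : 4 * (c * ((F.L : ℝ)⁻¹) ^ (K - J)) ≤ 1 := by nlinarith
  have h := junctionEnergy_le_purse F (J := J) U₀ ζ X hXdef w hw (c * ((F.L : ℝ)⁻¹) ^ (K - J)) hζc hM4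
  refine h.trans (mul_le_mul_of_nonneg_right ?_ (purse_nonneg F U₀ ζ))
  have hinv : ((F.L : ℝ)⁻¹) ^ (K - J) * (F.L : ℝ) ^ (K - J) = 1 := by
    rw [inv_pow, inv_mul_cancel₀ (pow_ne_zero _ hL0.ne')]
  have hpow : (F.L : ℝ) ^ (K - J - 1 - 1) ≤ (F.L : ℝ) ^ (K - J) := pow_le_pow_right₀ hL1.le (by omega)
  have hkey : (c * ((F.L : ℝ)⁻¹) ^ (K - J)) ^ 2 * ((F.L : ℝ) ^ (K - J - 1 - 1) * (F.L : ℝ) * (F.L : ℝ) ^ (K - J)) ≤ c ^ 2 * (F.L : ℝ) := by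
    calc (c * ((F.L : ℝ)⁻¹) ^ (K - J)) ^ 2 * ((F.L : ℝ) ^ (K - J - 1 - 1) * (F.L : ℝ) * (F.L : ℝ) ^ (K - J))
        ≤ (c * ((F.L : ℝ)⁻¹) ^ (K - J)) ^ 2 * ((F.L : ℝ) ^ (K - J) * (F.L : ℝ) * (F.L : ℝ) ^ (K - J)) := by gcongr
      _ = c ^ 2 * (F.L : ℝ) * (((F.L : ℝ)⁻¹) ^ (K - J) * (F.L : ℝ) ^ (K - J)) ^ 2 := by ring
      _ = c ^ 2 * (F.L : ℝ) := by rw [hinv]; ring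
  calc 2304 * w 1 * (c * ((F.L : ℝ)⁻¹) ^ (K - J)) ^ 2 * ((F.L : ℝ) ^ (K - J - 1 - 1) * (F.L : ℝ) * (F.L : ℝ) ^ (K - J))
      = 2304 * w 1 * ((c * ((F.L : ℝ)⁻¹) ^ (K - J)) ^ 2 * ((F.L : ℝ) ^ (K - J - 1 - 1) * (F.L : ℝ) * (F.L : ℝ) ^ (K - J))) := by ring
    _ ≤ 2304 * w 1 * (c ^ 2 * (F.L : ℝ)) := mul_le_mul_of_nonneg_left hkey (by positivity)
    _ = 2304 * w 1 * c ^ 2 * (F.L : ℝ) := by ring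


/-- ★★ **THE SHARP EXPONENT WHEN `2 ≤ K − J`**: under the same sup-decay letter, `E_J ≤ (2304·w(1)·c²·L⁻¹)·purse` (exact count
`M₀²·L^{K−J−2}·L·L^{K−J} = c²·L⁻¹`).  With `w 1 = 1`, `c ≤ 1∕4`: `E_J ≤ 144·L⁻¹·purse`.
[cite: Balaban1985Averaging, Prop. 4 (128)-(135) pp.37-38; Balaban1987RG1, (0.4), (0.11) p.253] -/
theorem junctionEnergy_le_purse_of_supDecay_sharp {J K : ℕ} (U₀ : GaugeField (F.P K) 0 (Matrix.specialUnitaryGroup (Fin 2) ℂ))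
    (ζ : PBond (F.P K) 0 → EuclideanSpace ℝ (Fin 3))
    (X : (i : ℕ) → PBond (F.P K) i → (specialUnitaryLogChart (Fin 2)).lie)
    (hXdef : X = fun (i : ℕ) (b : PBond (F.P K) i) =>
      (⟨su2Coord (rev (logVec (su2Quat (Averaging.iter (fun k => BlockAveraging.blockAvg (P := F.P K) (j := k) ℰp) i (fun ℓ => expPoint (ζ ℓ) * U₀ ℓ : GaugeField (F.P K) 0 (Matrix.specialUnitaryGroup (Fin 2) ℂ)) b * (Averaging.iter (fun k => BlockAveraging.blockAvg (P := F.P K) (j := k) ℰp) i U₀ b)⁻¹)))), su2Coord_rev_mem_lie _⟩ : (specialUnitaryLogChart (Fin 2)).lie))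
    (w : ℕ → ℝ) (hw : 0 ≤ w 1) (c : ℝ) (hc0 : 0 ≤ c) (hc4 : 4 * c ≤ 1)
    (hζc : ∀ ℓ : PBond (F.P K) 0, ‖ζ ℓ‖ ≤ c * ((F.L : ℝ)⁻¹) ^ (K - J)) (h2 : 2 ≤ K - J) :
      3 * ∑ i ∈ Finset.range (K - J), w (i + 1) * (F.L : ℝ) ^ (K - J - 1 - (i + 1)) *
          ∑ μ : Fin (F.P K).d, ∑ ν : Fin (F.P K).d, ∑ y' : Site (F.P K) (i + 1),
            (if i = 0 then ((Fintype.card (Idx (F.P K)) : ℝ)⁻¹ *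
            ∑ a ∈ (Finset.univ : Finset (Idx (F.P K))) ×ˢ (Finset.range (F.P K).L ×ˢ Finset.range (F.P K).L),
              (Real.exp (‖X i ⟨(shiftN (shiftN (Site.blockSite y' a.1.1) μ a.2.1) ν a.2.2), μ⟩‖ + ‖X i ⟨((shiftN (shiftN (Site.blockSite y' a.1.1) μ a.2.1) ν a.2.2)).shift μ, ν⟩‖ + ‖X i ⟨((shiftN (shiftN (Site.blockSite y' a.1.1) μ a.2.1) ν a.2.2)).shift ν, μ⟩‖ + ‖X i ⟨(shiftN (shiftN (Site.blockSite y' a.1.1) μ a.2.1) ν a.2.2), ν⟩‖) - 1 - (‖X i ⟨(shiftN (shiftN (Site.blockSite y' a.1.1) μ a.2.1) ν a.2.2), μ⟩‖ + ‖X i ⟨((shiftN (shiftN (Site.blockSite y' a.1.1) μ a.2.1) ν a.2.2)).shift μ, ν⟩‖ + ‖X i ⟨((shiftN (shiftN (Site.blockSite y' a.1.1) μ a.2.1) ν a.2.2)).shift ν, μ⟩‖ + ‖X i ⟨(shiftN (shiftN (Site.blockSite y' a.1.1) μ a.2.1) ν a.2.2), ν⟩‖))) else 0) ^ 2 ≤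
      (2304 * w 1 * c ^ 2 * (F.L : ℝ)⁻¹) *
        (((F.L : ℝ)⁻¹) ^ (K - J) * ∑ ℓ : PBond (F.P K) 0, ‖ζ ℓ‖ ^ 2 +
          (F.L : ℝ) ^ (K - J) * ∑ p : Plaq (F.P K) 0,
            (1 - reTr ((GaugeField.plaqHol U₀ p)⁻¹ * GaugeField.plaqHol (fun ℓ => expPoint (ζ ℓ) * U₀ ℓ : GaugeField (F.P K) 0 (Matrix.specialUnitaryGroup (Fin 2) ℂ)) p))) := by
  have hL1 : (1 : ℝ) < (F.L : ℝ) := by exact_mod_cast F.hL.2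
  have hL0 : (0 : ℝ) < (F.L : ℝ) := by linarith
  have hq0 : 0 ≤ ((F.L : ℝ)⁻¹) ^ (K - J) := pow_nonneg (inv_nonneg.2 hL0.le) _
  have hq1 : ((F.L : ℝ)⁻¹) ^ (K - J) ≤ 1 := pow_le_one₀ (inv_nonneg.2 hL0.le) (inv_le_one_of_one_le₀ hL1.le)
  have hM4 : 4 * (c * ((F.L : ℝ)⁻¹) ^ (K - J)) ≤ 1 := by nlinarith
  have h := junctionEnergy_le_purse F (J := J) U₀ ζ X hXdef w hw (c * ((F.L : ℝ)⁻¹) ^ (K - J)) hζc hM4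
  refine h.trans (mul_le_mul_of_nonneg_right (le_of_eq ?_) (purse_nonneg F U₀ ζ))
  obtain ⟨m, hm⟩ : ∃ m, K - J = m + 2 := ⟨K - J - 2, by omega⟩
  have hm2 : K - J - 1 - 1 = m := by omega
  rw [hm2, hm, inv_pow, pow_add]
  field_simp


/-! ## §2 The junction ROW in ⧗w4 g29 (d) `c1Budget_discharged`'s currency: `L^{K−J−2}·Σ_μΣ_νΣ_{y′ : Site (F.P K) (0+1)} junction₀(X)²` (text VERBATIM) -/

/-- ★ **THE SOURCE ROW, COUNTED** (the `i = 0` instance of ✓`junctionEnergy_le`'s two counts, stated on its own): for finest sizes `‖X 0 b‖ ≤ M₀`, `4M₀ ≤ 1`,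
`Σ_μΣ_νΣ_{y′}(|Idx|⁻¹·Σ_a rem₀)² ≤ L⁴·(L³)⁻¹·(256·3·M₀²·Σ_b‖X 0 b‖²)` (✓`sum_sq_idxAvg_le` with `d = 3`, then ✓`sum_sq_rem_le`).
[cite: Balaban1985Averaging, Prop. 4 (128)-(135) pp.37-38] -/
theorem junctionRow_le {K : ℕ} (X : (i : ℕ) → PBond (F.P K) i → (specialUnitaryLogChart (Fin 2)).lie)
    (M₀ : ℝ) (hM0 : ∀ b : PBond (F.P K) 0, ‖X 0 b‖ ≤ M₀) (hM4 : 4 * M₀ ≤ 1) :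
      ∑ μ : Fin (F.P K).d, ∑ ν : Fin (F.P K).d, ∑ y' : Site (F.P K) (0 + 1),
        (((Fintype.card (Idx (F.P K)) : ℝ)⁻¹ *
        ∑ a ∈ (Finset.univ : Finset (Idx (F.P K))) ×ˢ (Finset.range (F.P K).L ×ˢ Finset.range (F.P K).L),
          (Real.exp (‖X 0 ⟨(shiftN (shiftN (Site.blockSite y' a.1.1) μ a.2.1) ν a.2.2), μ⟩‖ + ‖X 0 ⟨((shiftN (shiftN (Site.blockSite y' a.1.1) μ a.2.1) ν a.2.2)).shift μ, ν⟩‖ + ‖X 0 ⟨((shiftN (shiftN (Site.blockSite y' a.1.1) μ a.2.1) ν a.2.2)).shift ν, μ⟩‖ + ‖X 0 ⟨(shiftN (shiftN (Site.blockSite y' a.1.1) μ a.2.1) ν a.2.2), ν⟩‖) - 1 - (‖X 0 ⟨(shiftN (shiftN (Site.blockSite y' a.1.1) μ a.2.1) ν a.2.2), μ⟩‖ + ‖X 0 ⟨((shiftN (shiftN (Site.blockSite y' a.1.1) μ a.2.1) ν a.2.2)).shift μ, ν⟩‖ + ‖X 0 ⟨((shiftN (shiftN (Site.blockSite y' a.1.1)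 μ a.2.1) ν a.2.2)).shift ν, μ⟩‖ + ‖X 0 ⟨(shiftN (shiftN (Site.blockSite y' a.1.1) μ a.2.1) ν a.2.2), ν⟩‖)))) ^ 2 ≤
      (F.L : ℝ) ^ 4 * ((F.L : ℝ) ^ 3)⁻¹ * (256 * (3 : ℝ) * M₀ ^ 2 * ∑ b : PBond (F.P K) 0, ‖X 0 b‖ ^ 2) := by
  have hm : 0 + 1 ≤ (F.P K).m + (F.P K).K := by show 0 + 1 ≤ F.m + K; have := F.hm; omega
  have hd3 : (F.P K).d = 3 := T3Family.P_d F K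
  have hLL : ((F.P K).L : ℝ) = (F.L : ℝ) := rfl
  calc _
      ≤ ∑ μ : Fin (F.P K).d, ∑ ν : Fin (F.P K).d, (((F.P K).L : ℝ) ^ 4 * (((F.P K).L : ℝ) ^ (F.P K).d)⁻¹ *
          ∑ x : Site (F.P K) 0, (Real.exp (‖X 0 ⟨x, μ⟩‖ + ‖X 0 ⟨x.shift μ, ν⟩‖ + ‖X 0 ⟨x.shift ν, μ⟩‖ + ‖X 0 ⟨x, ν⟩‖) - 1 -
            (‖X 0 ⟨x, μ⟩‖ + ‖X 0 ⟨x.shift μ, ν⟩‖ + ‖X 0 ⟨x.shift ν, μ⟩‖ + ‖X 0 ⟨x, ν⟩‖)) ^ 2) :=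
        Finset.sum_le_sum fun μ _ => Finset.sum_le_sum fun ν _ =>
          sum_sq_idxAvg_le (P := F.P K) (j := 0) hm μ ν
            (fun x => Real.exp (‖X 0 ⟨x, μ⟩‖ + ‖X 0 ⟨x.shift μ, ν⟩‖ + ‖X 0 ⟨x.shift ν, μ⟩‖ + ‖X 0 ⟨x, ν⟩‖) - 1 -
              (‖X 0 ⟨x, μ⟩‖ + ‖X 0 ⟨x.shift μ, ν⟩‖ + ‖X 0 ⟨x.shift ν, μ⟩‖ + ‖X 0 ⟨x, ν⟩‖))
    _ = ((F.P K).L : ℝ) ^ 4 * (((F.P K).L : ℝ) ^ (F.P K).d)⁻¹ *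
          ∑ μ : Fin (F.P K).d, ∑ ν : Fin (F.P K).d, ∑ x : Site (F.P K) 0,
            (Real.exp (‖X 0 ⟨x, μ⟩‖ + ‖X 0 ⟨x.shift μ, ν⟩‖ + ‖X 0 ⟨x.shift ν, μ⟩‖ + ‖X 0 ⟨x, ν⟩‖) - 1 -
              (‖X 0 ⟨x, μ⟩‖ + ‖X 0 ⟨x.shift μ, ν⟩‖ + ‖X 0 ⟨x.shift ν, μ⟩‖ + ‖X 0 ⟨x, ν⟩‖)) ^ 2 := by
        simp only [Finset.mul_sum]
    _ ≤ ((F.P K).L : ℝ) ^ 4 * (((F.P K).L : ℝ) ^ (F.P K).d)⁻¹ * (256 * ((F.P K).d : ℝ) * M₀ ^ 2 * ∑ b : PBond (F.P K) 0, ‖X 0 b‖ ^ 2) :=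
        mul_le_mul_of_nonneg_left (sum_sq_rem_le (fun b => ‖X 0 b‖) (fun b => norm_nonneg _) M₀ hM0 hM4) (by rw [hLL]; positivity)
    _ = (F.L : ℝ) ^ 4 * ((F.L : ℝ) ^ 3)⁻¹ * (256 * (3 : ℝ) * M₀ ^ 2 * ∑ b : PBond (F.P K) 0, ‖X 0 b‖ ^ 2) := by
        rw [hLL, hd3]; push_cast; ring

/-- ★★ **THE JUNCTION ROW IS A `K`-UNIFORM PURSE-SHARE AT A DECAYING REPRESENTATIVE** — in ⧗(d) `c1Budget_discharged`'s currency (its bracket term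
`3·(L^{K−J−2}·Σ junction₀(X)²)`, text VERBATIM): under the sup-decay letter `‖ζ ℓ‖ ≤ c·(L⁻¹)^{K−J}`, `4c ≤ 1`, for EVERY `J ≤ K`,
`L^{K−J−2}·Σ_μΣ_νΣ_{y′} junction₀(X)² ≤ (768·c²·L)·purse` (`c ≤ 1∕4`: `≤ 48·L·purse`).
[cite: Balaban1985Averaging, Prop. 4 (128)-(135) pp.37-38; Balaban1987RG1, (0.4), (0.11) p.253] -/
theorem junctionRow_le_purse_of_supDecay {J K : ℕ} (U₀ : GaugeField (F.P K) 0 (Matrix.specialUnitaryGroup (Fin 2) ℂ))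
    (ζ : PBond (F.P K) 0 → EuclideanSpace ℝ (Fin 3))
    (X : (i : ℕ) → PBond (F.P K) i → (specialUnitaryLogChart (Fin 2)).lie)
    (hXdef : X = fun (i : ℕ) (b : PBond (F.P K) i) =>
      (⟨su2Coord (rev (logVec (su2Quat (Averaging.iter (fun k => BlockAveraging.blockAvg (P := F.P K) (j := k) ℰp) i (fun ℓ => expPoint (ζ ℓ) * U₀ ℓ : GaugeField (F.P K) 0 (Matrix.specialUnitaryGroup (Fin 2) ℂ)) b * (Averaging.iter (fun k => BlockAveraging.blockAvg (P := F.P K) (j := k) ℰp) i U₀ b)⁻¹)))), su2Coord_rev_mem_lie _⟩ : (specialUnitaryLogChart (Fin 2)).lie))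
    (c : ℝ) (hc0 : 0 ≤ c) (hc4 : 4 * c ≤ 1)
    (hζc : ∀ ℓ : PBond (F.P K) 0, ‖ζ ℓ‖ ≤ c * ((F.L : ℝ)⁻¹) ^ (K - J)) :
      (F.L : ℝ) ^ (K - J - 2) *
          ∑ μ : Fin (F.P K).d, ∑ ν : Fin (F.P K).d, ∑ y' : Site (F.P K) (0 + 1),
            (((Fintype.card (Idx (F.P K)) : ℝ)⁻¹ *
            ∑ a ∈ (Finset.univ : Finset (Idx (F.P K))) ×ˢ (Finset.range (F.P K).L ×ˢ Finset.range (F.P K).L),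
              (Real.exp (‖X 0 ⟨(shiftN (shiftN (Site.blockSite y' a.1.1) μ a.2.1) ν a.2.2), μ⟩‖ + ‖X 0 ⟨((shiftN (shiftN (Site.blockSite y' a.1.1) μ a.2.1) ν a.2.2)).shift μ, ν⟩‖ + ‖X 0 ⟨((shiftN (shiftN (Site.blockSite y' a.1.1) μ a.2.1) ν a.2.2)).shift ν, μ⟩‖ + ‖X 0 ⟨(shiftN (shiftN (Site.blockSite y' a.1.1) μ a.2.1) ν a.2.2), ν⟩‖) - 1 - (‖X 0 ⟨(shiftN (shiftN (Site.blockSite y' a.1.1) μ a.2.1) ν a.2.2), μ⟩‖ + ‖X 0 ⟨((shiftN (shiftN (Site.blockSite y' a.1.1) μ a.2.1) ν a.2.2)).shift μ, ν⟩‖ + ‖X 0 ⟨((shiftN (shiftN (Site.blockSite y' a.1.1) μ a.2.1) ν a.2.2)).shift ν, μ⟩‖ + ‖X 0 ⟨(shiftN (shiftN (Site.blockSite y' a.1.1) μ a.2.1) ν a.2.2), ν⟩‖)))) ^ 2 ≤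
      (768 * c ^ 2 * (F.L : ℝ)) *
        (((F.L : ℝ)⁻¹) ^ (K - J) * ∑ ℓ : PBond (F.P K) 0, ‖ζ ℓ‖ ^ 2 +
          (F.L : ℝ) ^ (K - J) * ∑ p : Plaq (F.P K) 0,
            (1 - reTr ((GaugeField.plaqHol U₀ p)⁻¹ * GaugeField.plaqHol (fun ℓ => expPoint (ζ ℓ) * U₀ ℓ : GaugeField (F.P K) 0 (Matrix.specialUnitaryGroup (Fin 2) ℂ)) p))) := by
  have hL1 : (1 : ℝ) < (F.L : ℝ) := by exact_mod_cast F.hL.2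
  have hL0 : (0 : ℝ) < (F.L : ℝ) := by linarith
  have hq0 : 0 ≤ ((F.L : ℝ)⁻¹) ^ (K - J) := pow_nonneg (inv_nonneg.2 hL0.le) _
  have hq1 : ((F.L : ℝ)⁻¹) ^ (K - J) ≤ 1 := pow_le_one₀ (inv_nonneg.2 hL0.le) (inv_le_one_of_one_le₀ hL1.le)
  have hM4 : 4 * (c * ((F.L : ℝ)⁻¹) ^ (K - J)) ≤ 1 := by nlinarith
  have hX0 : ∀ b : PBond (F.P K) 0, ‖X 0 b‖ ≤ c * ((F.L : ℝ)⁻¹) ^ (K - J) :=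
    fun b => (norm_chartTower_zero_le F U₀ ζ X hXdef b).trans (hζc b)
  have hrow := junctionRow_le F X (c * ((F.L : ℝ)⁻¹) ^ (K - J)) hX0 hM4
  have hsum : ∑ b : PBond (F.P K) 0, ‖X 0 b‖ ^ 2 ≤ ∑ ℓ : PBond (F.P K) 0, ‖ζ ℓ‖ ^ 2 :=
    Finset.sum_le_sum fun b _ => pow_le_pow_left₀ (norm_nonneg _) (norm_chartTower_zero_le F U₀ ζ X hXdef b) 2
  have hREL : 0 ≤ ∑ p : Plaq (F.P K) 0,
      (1 - reTr ((GaugeField.plaqHol U₀ p)⁻¹ * GaugeField.plaqHol (fun ℓ => expPoint (ζ ℓ) * U₀ ℓ : GaugeField (F.P K) 0 (Matrix.specialUnitaryGroup (Fin 2) ℂ)) p)) :=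
    Finset.sum_nonneg fun p _ => sub_nonneg.2 (GaugeGroup.reTr_le_one _)
  have hinv : ((F.L : ℝ)⁻¹) ^ (K - J) * (F.L : ℝ) ^ (K - J) = 1 := by
    rw [inv_pow, inv_mul_cancel₀ (pow_ne_zero _ hL0.ne')]
  have hP0 := purse_nonneg F (J := J) U₀ ζ
  set Pu := (((F.L : ℝ)⁻¹) ^ (K - J) * ∑ ℓ : PBond (F.P K) 0, ‖ζ ℓ‖ ^ 2 +
          (F.L : ℝ) ^ (K - J) * ∑ p : Plaq (F.P K) 0,
            (1 - reTr ((GaugeField.plaqHol U₀ p)⁻¹ * GaugeField.plaqHol (fun ℓ => expPoint (ζ ℓ) * U₀ ℓ : GaugeField (F.P K) 0 (Matrix.specialUnitaryGroup (Fin 2) ℂ)) p))) with hPu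
  -- `Σ‖ζ‖² ≤ L^{K−J}·Pu`
  have hpurse : ∑ ℓ : PBond (F.P K) 0, ‖ζ ℓ‖ ^ 2 ≤ (F.L : ℝ) ^ (K - J) * Pu := by
    have hpow : 0 ≤ (F.L : ℝ) ^ (K - J) := pow_nonneg hL0.le _
    rw [hPu]
    calc ∑ ℓ : PBond (F.P K) 0, ‖ζ ℓ‖ ^ 2 = ((F.L : ℝ) ^ (K - J) * ((F.L : ℝ)⁻¹) ^ (K - J)) * ∑ ℓ : PBond (F.P K) 0, ‖ζ ℓ‖ ^ 2 + 0 := by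
          rw [mul_comm ((F.L : ℝ) ^ (K - J)), hinv]; ring
      _ ≤ ((F.L : ℝ) ^ (K - J) * ((F.L : ℝ)⁻¹) ^ (K - J)) * ∑ ℓ : PBond (F.P K) 0, ‖ζ ℓ‖ ^ 2 +
          (F.L : ℝ) ^ (K - J) * ((F.L : ℝ) ^ (K - J) * ∑ p : Plaq (F.P K) 0,
            (1 - reTr ((GaugeField.plaqHol U₀ p)⁻¹ * GaugeField.plaqHol (fun ℓ => expPoint (ζ ℓ) * U₀ ℓ : GaugeField (F.P K) 0 (Matrix.specialUnitaryGroup (Fin 2) ℂ)) p))) :=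
          add_le_add le_rfl (mul_nonneg hpow (mul_nonneg hpow hREL))
      _ = _ := by ring
  have h43 : (F.L : ℝ) ^ 4 * ((F.L : ℝ) ^ 3)⁻¹ = (F.L : ℝ) := by field_simp
  rw [h43] at hrow
  have hT := hrow.trans (mul_le_mul_of_nonneg_left (mul_le_mul_of_nonneg_left (hsum.trans hpurse) (by positivity)) hL0.le)
  have hC0 : 0 ≤ 768 * c ^ 2 * (F.L : ℝ) * Pu := mul_nonneg (by positivity) hP0
  have hpowle : (F.L : ℝ) ^ (K - J - 2) ≤ (F.L : ℝ) ^ (K - J) := pow_le_pow_right₀ hL1.le (by omega)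
  have hgeo : (F.L : ℝ) ^ (K - J - 2) * ((F.L : ℝ)⁻¹) ^ (K - J) * (((F.L : ℝ)⁻¹) ^ (K - J) * (F.L : ℝ) ^ (K - J)) ≤ 1 := by
    rw [hinv, mul_one]
    calc (F.L : ℝ) ^ (K - J - 2) * ((F.L : ℝ)⁻¹) ^ (K - J) ≤ (F.L : ℝ) ^ (K - J) * ((F.L : ℝ)⁻¹) ^ (K - J) :=
          mul_le_mul_of_nonneg_right hpowle hq0
      _ = 1 := by rw [mul_comm, hinv]
  calc _ ≤ (F.L : ℝ) ^ (K - J - 2) * ((F.L : ℝ) * (256 * (3 : ℝ) * (c * ((F.L : ℝ)⁻¹) ^ (K - J)) ^ 2 * ((F.L : ℝ) ^ (K - J) * Pu))) :=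
        mul_le_mul_of_nonneg_left hT (pow_nonneg hL0.le _)
    _ = (768 * c ^ 2 * (F.L : ℝ) * Pu) * ((F.L : ℝ) ^ (K - J - 2) * ((F.L : ℝ)⁻¹) ^ (K - J) * (((F.L : ℝ)⁻¹) ^ (K - J) * (F.L : ℝ) ^ (K - J))) := by ring
    _ ≤ (768 * c ^ 2 * (F.L : ℝ) * Pu) * 1 := mul_le_mul_of_nonneg_left hgeo hC0
    _ = (768 * c ^ 2 * (F.L : ℝ)) * Pu := by ring

/-- ★★ **THE SHARP EXPONENT WHEN `2 ≤ K − J`**, same currency: `L^{K−J−2}·Σ junction₀(X)² ≤ (768·c²·L⁻¹)·purse` (`c ≤ 1∕4`: `≤ 48·L⁻¹·purse`).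
[cite: Balaban1985Averaging, Prop. 4 (128)-(135) pp.37-38; Balaban1987RG1, (0.4), (0.11) p.253] -/
theorem junctionRow_le_purse_of_supDecay_sharp {J K : ℕ} (U₀ : GaugeField (F.P K) 0 (Matrix.specialUnitaryGroup (Fin 2) ℂ))
    (ζ : PBond (F.P K) 0 → EuclideanSpace ℝ (Fin 3))
    (X : (i : ℕ) → PBond (F.P K) i → (specialUnitaryLogChart (Fin 2)).lie)
    (hXdef : X = fun (i : ℕ) (b : PBond (F.P K) i) =>
      (⟨su2Coord (rev (logVec (su2Quat (Averaging.iter (fun k => BlockAveraging.blockAvg (P := F.P K) (j := k) ℰp) i (fun ℓ => expPoint (ζ ℓ) * U₀ ℓ : GaugeField (F.P K) 0 (Matrix.specialUnitaryGroup (Fin 2) ℂ)) b * (Averaging.iter (fun k => BlockAveraging.blockAvg (P := F.P K) (j := k) ℰp) i U₀ b)⁻¹)))), su2Coord_rev_mem_lie _⟩ : (specialUnitaryLogChart (Fin 2)).lie))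
    (c : ℝ) (hc0 : 0 ≤ c) (hc4 : 4 * c ≤ 1)
    (hζc : ∀ ℓ : PBond (F.P K) 0, ‖ζ ℓ‖ ≤ c * ((F.L : ℝ)⁻¹) ^ (K - J)) (h2 : 2 ≤ K - J) :
      (F.L : ℝ) ^ (K - J - 2) *
          ∑ μ : Fin (F.P K).d, ∑ ν : Fin (F.P K).d, ∑ y' : Site (F.P K) (0 + 1),
            (((Fintype.card (Idx (F.P K)) : ℝ)⁻¹ *
            ∑ a ∈ (Finset.univ : Finset (Idx (F.P K))) ×ˢ (Finset.range (F.P K).L ×ˢ Finset.range (F.P K).L),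
              (Real.exp (‖X 0 ⟨(shiftN (shiftN (Site.blockSite y' a.1.1) μ a.2.1) ν a.2.2), μ⟩‖ + ‖X 0 ⟨((shiftN (shiftN (Site.blockSite y' a.1.1) μ a.2.1) ν a.2.2)).shift μ, ν⟩‖ + ‖X 0 ⟨((shiftN (shiftN (Site.blockSite y' a.1.1) μ a.2.1) ν a.2.2)).shift ν, μ⟩‖ + ‖X 0 ⟨(shiftN (shiftN (Site.blockSite y' a.1.1) μ a.2.1) ν a.2.2), ν⟩‖) - 1 - (‖X 0 ⟨(shiftN (shiftN (Site.blockSite y' a.1.1) μ a.2.1) ν a.2.2), μ⟩‖ + ‖X 0 ⟨((shiftN (shiftN (Site.blockSite y' a.1.1) μ a.2.1) ν a.2.2)).shift μ, ν⟩‖ + ‖X 0 ⟨((shiftN (shiftN (Site.blockSite y' a.1.1) μ a.2.1) ν a.2.2)).shift ν, μ⟩‖ + ‖X 0 ⟨(shiftN (shiftN (Site.blockSite y' a.1.1) μ a.2.1) ν a.2.2), ν⟩‖)))) ^ 2 ≤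
      (768 * c ^ 2 * (F.L : ℝ)⁻¹) *
        (((F.L : ℝ)⁻¹) ^ (K - J) * ∑ ℓ : PBond (F.P K) 0, ‖ζ ℓ‖ ^ 2 +
          (F.L : ℝ) ^ (K - J) * ∑ p : Plaq (F.P K) 0,
            (1 - reTr ((GaugeField.plaqHol U₀ p)⁻¹ * GaugeField.plaqHol (fun ℓ => expPoint (ζ ℓ) * U₀ ℓ : GaugeField (F.P K) 0 (Matrix.specialUnitaryGroup (Fin 2) ℂ)) p))) := by
  have hL1 : (1 : ℝ) < (F.L : ℝ) := by exact_mod_cast F.hL.2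
  have hL0 : (0 : ℝ) < (F.L : ℝ) := by linarith
  have hq0 : 0 ≤ ((F.L : ℝ)⁻¹) ^ (K - J) := pow_nonneg (inv_nonneg.2 hL0.le) _
  have hq1 : ((F.L : ℝ)⁻¹) ^ (K - J) ≤ 1 := pow_le_one₀ (inv_nonneg.2 hL0.le) (inv_le_one_of_one_le₀ hL1.le)
  have hM4 : 4 * (c * ((F.L : ℝ)⁻¹) ^ (K - J)) ≤ 1 := by nlinarith
  have hX0 : ∀ b : PBond (F.P K) 0, ‖X 0 b‖ ≤ c * ((F.L : ℝ)⁻¹) ^ (K - J) :=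
    fun b => (norm_chartTower_zero_le F U₀ ζ X hXdef b).trans (hζc b)
  have hrow := junctionRow_le F X (c * ((F.L : ℝ)⁻¹) ^ (K - J)) hX0 hM4
  have hsum : ∑ b : PBond (F.P K) 0, ‖X 0 b‖ ^ 2 ≤ ∑ ℓ : PBond (F.P K) 0, ‖ζ ℓ‖ ^ 2 :=
    Finset.sum_le_sum fun b _ => pow_le_pow_left₀ (norm_nonneg _) (norm_chartTower_zero_le F U₀ ζ X hXdef b) 2
  have hREL : 0 ≤ ∑ p : Plaq (F.P K) 0,
      (1 - reTr ((GaugeField.plaqHol U₀ p)⁻¹ * GaugeField.plaqHol (fun ℓ => expPoint (ζ ℓ) * U₀ ℓ : GaugeField (F.P K) 0 (Matrix.specialUnitaryGroup (Fin 2) ℂ)) p)) :=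
    Finset.sum_nonneg fun p _ => sub_nonneg.2 (GaugeGroup.reTr_le_one _)
  have hinv : ((F.L : ℝ)⁻¹) ^ (K - J) * (F.L : ℝ) ^ (K - J) = 1 := by
    rw [inv_pow, inv_mul_cancel₀ (pow_ne_zero _ hL0.ne')]
  have hP0 := purse_nonneg F (J := J) U₀ ζ
  set Pu := (((F.L : ℝ)⁻¹) ^ (K - J) * ∑ ℓ : PBond (F.P K) 0, ‖ζ ℓ‖ ^ 2 +
          (F.L : ℝ) ^ (K - J) * ∑ p : Plaq (F.P K) 0,
            (1 - reTr ((GaugeField.plaqHol U₀ p)⁻¹ * GaugeField.plaqHol (fun ℓ => expPoint (ζ ℓ) * U₀ ℓ : GaugeField (F.P K) 0 (Matrix.specialUnitaryGroup (Fin 2) ℂ)) p))) with hPu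
  -- `Σ‖ζ‖² ≤ L^{K−J}·Pu`
  have hpurse : ∑ ℓ : PBond (F.P K) 0, ‖ζ ℓ‖ ^ 2 ≤ (F.L : ℝ) ^ (K - J) * Pu := by
    have hpow : 0 ≤ (F.L : ℝ) ^ (K - J) := pow_nonneg hL0.le _
    rw [hPu]
    calc ∑ ℓ : PBond (F.P K) 0, ‖ζ ℓ‖ ^ 2 = ((F.L : ℝ) ^ (K - J) * ((F.L : ℝ)⁻¹) ^ (K - J)) * ∑ ℓ : PBond (F.P K) 0, ‖ζ ℓ‖ ^ 2 + 0 := by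
          rw [mul_comm ((F.L : ℝ) ^ (K - J)), hinv]; ring
      _ ≤ ((F.L : ℝ) ^ (K - J) * ((F.L : ℝ)⁻¹) ^ (K - J)) * ∑ ℓ : PBond (F.P K) 0, ‖ζ ℓ‖ ^ 2 +
          (F.L : ℝ) ^ (K - J) * ((F.L : ℝ) ^ (K - J) * ∑ p : Plaq (F.P K) 0,
            (1 - reTr ((GaugeField.plaqHol U₀ p)⁻¹ * GaugeField.plaqHol (fun ℓ => expPoint (ζ ℓ) * U₀ ℓ : GaugeField (F.P K) 0 (Matrix.specialUnitaryGroup (Fin 2) ℂ)) p))) :=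
          add_le_add le_rfl (mul_nonneg hpow (mul_nonneg hpow hREL))
      _ = _ := by ring
  have h43 : (F.L : ℝ) ^ 4 * ((F.L : ℝ) ^ 3)⁻¹ = (F.L : ℝ) := by field_simp
  rw [h43] at hrow
  have hT := hrow.trans (mul_le_mul_of_nonneg_left (mul_le_mul_of_nonneg_left (hsum.trans hpurse) (by positivity)) hL0.le)
  calc _ ≤ (F.L : ℝ) ^ (K - J - 2) * ((F.L : ℝ) * (256 * (3 : ℝ) * (c * ((F.L : ℝ)⁻¹) ^ (K - J)) ^ 2 * ((F.L : ℝ) ^ (K - J) * Pu))) :=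
        mul_le_mul_of_nonneg_left hT (pow_nonneg hL0.le _)
    _ = (768 * c ^ 2 * (F.L : ℝ)⁻¹) * Pu := by
        obtain ⟨m, hm⟩ : ∃ m, K - J = m + 2 := ⟨K - J - 2, by omega⟩
        have hm2 : K - J - 2 = m := by omega
        rw [hm2, hm, inv_pow, pow_add]
        field_simp
        ring

end Summit.QuantumFields.YangMills.Theorems.FluctuationComparisonRegPrIntLS2BetaJunctionEnergyShare

end
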